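import Summits.ResolutionOfSingularities.ResolutionOfSingularities.Theorems.FrobeniusLadderFRationalResolutionSharpProjection
import Summits.ResolutionOfSingularities.ResolutionOfSingularities.Theorems.FrobeniusLadderFRationalResolutionSharpSection
import Mathlib.RingTheory.Localization.Away.Basic
import HarnessLib

/-!
# Crux `FrobeniusLadder.FRationalResolution` (stmt-ResolutionOfSingularities-15317), line `redirect`,
# stub `stub_diagonalizableQuotientResolution` — the SHARPENED CHART `ψ♯(m) = x^m · y^{s(m)} / h^K` (fifth brick of the «sharpening»
# step for WILD non-fixed points, memo MEMO-15317-leafhand4-g1 §remaining (1))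

Generic. Let `ψ : P(c) → R₀` be a chart on `P(c) = ℤᴺ_{≥0} ⊓ ker(v ↦ Σ v_l c_l)` (the unit-exponent chart of `…WildLogRegularNhd`),
split `Fin N ≃ Fin n ⊕ Fin m` (`inr` = the unit exponents), let `z = (0, (ord c_{inr j})_j) ∈ P(c)` and `h = ψ(z)`, and let `R`
be a localization of `R₀` in which `h` is invertible. With the linear section `s` of `…SharpSection` (✓ p825397) we build a chart
`ψ♯ : P(c♯) → R` on the sharpened monoid `P(c♯)` of `…SharpProjection` (✓ p825296): `ψ♯(m) = ψ(m, s m + K·ord) · h^{−K}`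
(`K = K(m) = Σⱼ |s(m)ⱼ|` makes the exponents non-negative). Properties: (1) the projection `π : P(c) → P(c♯)` is onto;
(2) `ψ(p) = ψ♯(π p) · unit` for every `p ∈ P(c)` (the vertical monomials `ψ(0, g)`, `Σ gⱼ c_{inr j} = 0`, divide powers of `h`);
(3) `ψ♯(m) · h^K = ψ(v)` for an explicit lift `v` of `m`; (4) the vertical generators `(0, ord_j e_j)` lie in `P(c)` and map to
units. These are the inputs of `…LogChartUnitTransfer` (✓ p825267) and `…SharpRank` (✓ p825382).

* `sum_split`, `elim_mem_iff` — bookkeeping along the splitting;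
* `exists_vertical` — the element `z = (0, ord) ∈ P(c)`;
* **`exists_sharp_chart`** — the statement above.

Honest label: bookkeeping brick (no stub closed). No definitions, no named facts, no sorry. [cite: Kato1994, (1.5)–(1.6), Def. (2.1)]
-/

-- single-problem summit: the doubled namespace component is forced
set_option linter.dupNamespace false

namespace Summit.ResolutionOfSingularities.ResolutionOfSingularities.Theorems.FRationalResolution.SharpChart

open Summit.ResolutionOfSingularities.ResolutionOfSingularities.Theorems.FRationalResolution

universe u w

variable {A : Type w} [AddCommGroup A] {R₀ : Type u} [CommRing R₀] {N n m : ℕ}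

/-- The sum over `Fin N` splits along `e : Fin n ⊕ Fin m ≃ Fin N`. [folklore] -/
theorem sum_split (e : Fin n ⊕ Fin m ≃ Fin N) (c : Fin N → A) (v : Fin N → ℤ) :
    ∑ l, v l • c l = (∑ i, v (e (Sum.inl i)) • c (e (Sum.inl i))) + ∑ j, v (e (Sum.inr j)) • c (e (Sum.inr j)) := by
  rw [← Fintype.sum_equiv e (fun x => v (e x) • c (e x)) (fun l => v l • c l) (fun x => rfl), Fintype.sum_sum_type]

/-- Membership of a vector given by its `inl`/`inr` parts in `P(c)`. [folklore] -/
theorem elim_mem_iff (e : Fin n ⊕ Fin m ≃ Fin N) (c : Fin N → A) (mv : Fin n → ℤ) (w : Fin m → ℤ) :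
    (fun l => Sum.elim mv w (e.symm l)) ∈ (AddSubmonoid.nonneg (Fin N → ℤ) ⊓
      AddMonoidHom.mker (Fintype.linearCombination ℤ c).toAddMonoidHom) ↔
      0 ≤ mv ∧ 0 ≤ w ∧ (∑ i, mv i • c (e (Sum.inl i))) + ∑ j, w j • c (e (Sum.inr j)) = 0 := by
  rw [SharpProjection.mem_chartMonoid_iff', sum_split e]
  simp only [Equiv.symm_apply_apply, Sum.elim_inl, Sum.elim_inr]
  constructor
  · rintro ⟨h0, hsum⟩
    refine ⟨fun i => ?_, fun j => ?_, hsum⟩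
    · simpa using h0 (e (Sum.inl i))
    · simpa using h0 (e (Sum.inr j))
  · rintro ⟨hm, hw, hsum⟩
    refine ⟨fun l => ?_, hsum⟩
    show 0 ≤ Sum.elim mv w (e.symm l)
    rcases e.symm l with i | j
    · exact hm i
    · exact hw j

/-- **The vertical element `z = (0, ord) ∈ P(c)`.** [folklore] -/
theorem exists_vertical (e : Fin n ⊕ Fin m ≃ Fin N) (c : Fin N → A) :
    ∃ z : ↥(AddSubmonoid.nonneg (Fin N → ℤ) ⊓ AddMonoidHom.mker (Fintype.linearCombination ℤ c).toAddMonoidHom),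
      (∀ i, (z : Fin N → ℤ) (e (Sum.inl i)) = 0) ∧
      ∀ j, (z : Fin N → ℤ) (e (Sum.inr j)) = (addOrderOf (c (e (Sum.inr j))) : ℤ) := by
  refine ⟨⟨fun l => Sum.elim (fun _ : Fin n => (0 : ℤ)) (fun j => (addOrderOf (c (e (Sum.inr j))) : ℤ)) (e.symm l),
    (elim_mem_iff e c _ _).mpr ⟨le_rfl, fun j => by positivity, ?_⟩⟩, fun i => by simp, fun j => by simp⟩
  simp [natCast_zsmul, addOrderOf_nsmul_eq_zero]

/-- **The sharpened chart.** See the module docstring. [cite: Kato1994, (1.5)–(1.6), Def. (2.1)] -/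
theorem exists_sharp_chart (e : Fin n ⊕ Fin m ≃ Fin N) (c : Fin N → A) (hc : ∀ l, IsOfFinAddOrder (c l))
    (ψ : Multiplicative ↥(AddSubmonoid.nonneg (Fin N → ℤ) ⊓
      AddMonoidHom.mker (Fintype.linearCombination ℤ c).toAddMonoidHom) →* R₀)
    (z : ↥(AddSubmonoid.nonneg (Fin N → ℤ) ⊓ AddMonoidHom.mker (Fintype.linearCombination ℤ c).toAddMonoidHom))
    (hz₁ : ∀ i, (z : Fin N → ℤ) (e (Sum.inl i)) = 0)
    (hz₂ : ∀ j, (z : Fin N → ℤ) (e (Sum.inr j)) = (addOrderOf (c (e (Sum.inr j))) : ℤ))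
    (R : Type u) [CommRing R] [Algebra R₀ R] [IsLocalization.Away (ψ (Multiplicative.ofAdd z)) R] :
    ∃ (π : ↥(AddSubmonoid.nonneg (Fin N → ℤ) ⊓ AddMonoidHom.mker (Fintype.linearCombination ℤ c).toAddMonoidHom) →+
        ↥(AddSubmonoid.nonneg (Fin n → ℤ) ⊓ AddMonoidHom.mker (Fintype.linearCombination ℤ (fun i : Fin n =>
          (Submodule.span ℤ (Set.range fun j : Fin m => c (e (Sum.inr j)))).mkQ (c (e (Sum.inl i))))).toAddMonoidHom))
      (ψ' : Multiplicative ↥(AddSubmonoid.nonneg (Fin n → ℤ) ⊓ AddMonoidHom.mker (Fintype.linearCombination ℤ (fun i : Fin n =>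
          (Submodule.span ℤ (Set.range fun j : Fin m => c (e (Sum.inr j)))).mkQ (c (e (Sum.inl i))))).toAddMonoidHom) →* R),
      (∀ p i, ((π p : _) : Fin n → ℤ) i = (p : Fin N → ℤ) (e (Sum.inl i))) ∧
      Function.Surjective π ∧
      (∀ p, ∃ u : R, IsUnit u ∧ algebraMap R₀ R (ψ (Multiplicative.ofAdd p)) = ψ' (Multiplicative.ofAdd (π p)) * u) ∧
      (∀ mv : ↥(AddSubmonoid.nonneg (Fin n → ℤ) ⊓ AddMonoidHom.mker (Fintype.linearCombination ℤ (fun i : Fin n =>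
          (Submodule.span ℤ (Set.range fun j : Fin m => c (e (Sum.inr j)))).mkQ (c (e (Sum.inl i))))).toAddMonoidHom),
        ∃ (v : ↥(AddSubmonoid.nonneg (Fin N → ℤ) ⊓ AddMonoidHom.mker (Fintype.linearCombination ℤ c).toAddMonoidHom))
          (K : ℕ), (∀ i, (v : Fin N → ℤ) (e (Sum.inl i)) = (mv : Fin n → ℤ) i) ∧
          ψ' (Multiplicative.ofAdd mv) * algebraMap R₀ R (ψ (Multiplicative.ofAdd z)) ^ K =
            algebraMap R₀ R (ψ (Multiplicative.ofAdd v))) ∧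
      (∀ j, ∃ zj : ↥(AddSubmonoid.nonneg (Fin N → ℤ) ⊓ AddMonoidHom.mker (Fintype.linearCombination ℤ c).toAddMonoidHom),
          (∀ i, (zj : Fin N → ℤ) (e (Sum.inl i)) = 0) ∧
          (∀ j', (zj : Fin N → ℤ) (e (Sum.inr j')) = if j' = j then (addOrderOf (c (e (Sum.inr j))) : ℤ) else 0) ∧
          IsUnit (algebraMap R₀ R (ψ (Multiplicative.ofAdd zj)))) := by
  classical
  have hord : ∀ j, 0 < addOrderOf (c (e (Sum.inr j))) := fun j => (hc _).addOrderOf_pos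
  have hKord : ∀ (K : ℤ) (j : Fin m), (K * (addOrderOf (c (e (Sum.inr j))) : ℤ)) • c (e (Sum.inr j)) = 0 := by
    intro K j
    rw [mul_zsmul, natCast_zsmul, addOrderOf_nsmul_eq_zero, zsmul_zero]
  -- facts about the two concrete monoids, then make them opaque
  have hproj := fun mv => SharpProjection.exists_mem_chartMonoid_proj_iff e c hc mv
  have helim := fun mv w => elim_mem_iff e c mv w
  have hmem := fun v => SharpProjection.mem_chartMonoid_iff' c v
  have hPsK : ∀ mv, mv ∈ (AddSubmonoid.nonneg (Fin n → ℤ) ⊓ AddMonoidHom.mker (Fintype.linearCombination ℤ (fun i : Fin n =>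
      (Submodule.span ℤ (Set.range fun j : Fin m => c (e (Sum.inr j)))).mkQ (c (e (Sum.inl i))))).toAddMonoidHom) →
      0 ≤ mv ∧ mv ∈ LinearMap.ker (Fintype.linearCombination ℤ (fun i : Fin n =>
        (Submodule.span ℤ (Set.range fun j : Fin m => c (e (Sum.inr j)))).mkQ (c (e (Sum.inl i))))) :=
    fun mv h => ⟨AddSubmonoid.mem_nonneg.mp (AddSubmonoid.mem_inf.mp h).1, AddMonoidHom.mem_mker.mp (AddSubmonoid.mem_inf.mp h).2⟩
  obtain ⟨s, hs⟩ := SharpSection.exists_linear_section e c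
  generalize (AddSubmonoid.nonneg (Fin N → ℤ) ⊓
    AddMonoidHom.mker (Fintype.linearCombination ℤ c).toAddMonoidHom) = P at ψ z hproj helim hmem ⊢
  generalize (AddSubmonoid.nonneg (Fin n → ℤ) ⊓ AddMonoidHom.mker (Fintype.linearCombination ℤ (fun i : Fin n =>
      (Submodule.span ℤ (Set.range fun j : Fin m => c (e (Sum.inr j)))).mkQ (c (e (Sum.inl i))))).toAddMonoidHom) = Ps
    at hproj hPsK ⊢
  -- membership in `P` by parts; extensionality along the splitting
  have hmemP : ∀ p : P, (∀ i, 0 ≤ (p : Fin N → ℤ) (e (Sum.inl i))) ∧ (∀ j, 0 ≤ (p : Fin N → ℤ) (e (Sum.inr j))) ∧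
      (∑ i, (p : Fin N → ℤ) (e (Sum.inl i)) • c (e (Sum.inl i))) + ∑ j, (p : Fin N → ℤ) (e (Sum.inr j)) • c (e (Sum.inr j)) = 0 := by
    intro p
    have hp := (hmem _).mp p.2
    rw [sum_split e] at hp
    exact ⟨fun i => hp.1 _, fun j => hp.1 _, hp.2⟩
  have hext : ∀ (v w : Fin N → ℤ), (∀ i, v (e (Sum.inl i)) = w (e (Sum.inl i))) →
      (∀ j, v (e (Sum.inr j)) = w (e (Sum.inr j))) → v = w := by
    intro v w h1 h2
    funext l
    obtain ⟨x, rfl⟩ := e.surjective l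
    rcases x with i | j
    · exact h1 i
    · exact h2 j
  have hzK : ∀ (K : ℕ) (l : Fin N), ((K • z : P) : Fin N → ℤ) l = (K : ℤ) * (z : Fin N → ℤ) l := fun K l => by
    rw [AddSubmonoidClass.coe_nsmul, Pi.smul_apply, nsmul_eq_mul]
  -- (1) the projection `π`
  have hπmem : ∀ p : P, (fun i => (p : Fin N → ℤ) (e (Sum.inl i))) ∈ Ps :=
    fun p => (hproj _).mp ⟨p, p.2, fun i => rfl⟩
  let π : P →+ Ps :=
    { toFun := fun p => ⟨fun i => (p : Fin N → ℤ) (e (Sum.inl i)), hπmem p⟩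
      map_zero' := Subtype.ext (funext fun i => rfl)
      map_add' := fun p q => Subtype.ext (funext fun i => rfl) }
  have hπapply : ∀ p i, ((π p : Ps) : Fin n → ℤ) i = (p : Fin N → ℤ) (e (Sum.inl i)) := fun p i => rfl
  have hπsurj : Function.Surjective π := by
    intro mv
    obtain ⟨v, hv, hvm⟩ := (hproj (mv : Fin n → ℤ)).mpr mv.2
    exact ⟨⟨v, hv⟩, Subtype.ext (funext fun i => hvm i)⟩
  -- (2) the linear section, as a function on `Ps`
  let sP : Ps → (Fin m → ℤ) := fun mv => s ⟨(mv : Fin n → ℤ), (hPsK _ mv.2).2⟩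
  have hsP_add : ∀ a b : Ps, sP (a + b) = sP a + sP b := by
    intro a b
    have h : (⟨((a + b : Ps) : Fin n → ℤ), (hPsK _ (a + b).2).2⟩ : LinearMap.ker _) =
        ⟨(a : Fin n → ℤ), (hPsK _ a.2).2⟩ + ⟨(b : Fin n → ℤ), (hPsK _ b.2).2⟩ := Subtype.ext rfl
    show s _ = s _ + s _
    rw [h, map_add]
  have hsP_zero : sP 0 = 0 := by
    have h : (⟨((0 : Ps) : Fin n → ℤ), (hPsK _ (0 : Ps).2).2⟩ : LinearMap.ker _) = 0 := Subtype.ext rfl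
    show s _ = 0
    rw [h, map_zero]
  have hsP_rel : ∀ mv : Ps, (∑ i, (mv : Fin n → ℤ) i • c (e (Sum.inl i))) + ∑ j, sP mv j • c (e (Sum.inr j)) = 0 :=
    fun mv => hs ⟨(mv : Fin n → ℤ), (hPsK _ mv.2).2⟩
  -- the correction size and the lift `(mv, s mv + K·ord)`
  let Kf : Ps → ℕ := fun mv => ∑ j, (sP mv j).natAbs
  have hKf_ge : ∀ (mv : Ps) (j : Fin m), ((sP mv j).natAbs : ℤ) ≤ (Kf mv : ℤ) := fun mv j => by
    have : (sP mv j).natAbs ≤ Kf mv :=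
      Finset.single_le_sum (f := fun j => (sP mv j).natAbs) (fun _ _ => Nat.zero_le _) (Finset.mem_univ j)
    exact_mod_cast this
  let liftv : Ps → (Fin N → ℤ) := fun mv l =>
    Sum.elim (fun i => (mv : Fin n → ℤ) i) (fun j => sP mv j + (Kf mv : ℤ) * (addOrderOf (c (e (Sum.inr j))) : ℤ)) (e.symm l)
  have hlift_mem : ∀ mv : Ps, liftv mv ∈ P := by
    intro mv
    refine (helim _ _).mpr ⟨(hPsK _ mv.2).1, fun j => ?_, ?_⟩
    · show (0 : ℤ) ≤ sP mv j + (Kf mv : ℤ) * (addOrderOf (c (e (Sum.inr j))) : ℤ)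
      have h1 := hKf_ge mv j
      have h2 : (1 : ℤ) ≤ (addOrderOf (c (e (Sum.inr j))) : ℤ) := by exact_mod_cast hord j
      have h3 : -(sP mv j) ≤ ((sP mv j).natAbs : ℤ) := by rw [Int.natCast_natAbs]; exact neg_le_abs _
      nlinarith
    · simp only [add_smul, Finset.sum_add_distrib, ← add_assoc, hsP_rel mv, zero_add]
      exact Finset.sum_eq_zero fun j _ => hKord _ j
  let lift : Ps → P := fun mv => ⟨liftv mv, hlift_mem mv⟩
  have hlift_inl : ∀ mv i, ((lift mv : P) : Fin N → ℤ) (e (Sum.inl i)) = (mv : Fin n → ℤ) i := fun mv i => by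
    simp [lift, liftv]
  have hlift_inr : ∀ mv j, ((lift mv : P) : Fin N → ℤ) (e (Sum.inr j)) =
      sP mv j + (Kf mv : ℤ) * (addOrderOf (c (e (Sum.inr j))) : ℤ) := fun mv j => by
    simp [lift, liftv]
  -- the additivity defect of the lift is a multiple of `z`
  have hlift_add : ∀ a b : Ps, lift a + lift b + Kf (a + b) • z = lift (a + b) + (Kf a + Kf b) • z := by
    intro a b
    apply Subtype.ext
    apply hext
    · intro i
      simp only [AddSubmonoid.coe_add, Pi.add_apply, hzK, hlift_inl, hz₁, mul_zero, add_zero]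
    · intro j
      simp only [AddSubmonoid.coe_add, Pi.add_apply, hzK, hlift_inr, hz₂, hsP_add, Pi.add_apply, Nat.cast_add]
      ring
  have hlift_zero : lift 0 = 0 := by
    apply Subtype.ext
    apply hext
    · intro i; rw [hlift_inl]; rfl
    · intro j
      rw [hlift_inr, hsP_zero]
      have hK0 : Kf 0 = 0 := by
        show ∑ j, (sP 0 j).natAbs = 0
        simp [hsP_zero]
      rw [hK0]
      simp
  -- (3) the unit `h = ψ(z)` in `R` and the sharpened chart
  set hR : R := algebraMap R₀ R (ψ (Multiplicative.ofAdd z)) with hhR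
  obtain ⟨uh, huh⟩ := IsLocalization.Away.algebraMap_isUnit (S := R) (ψ (Multiplicative.ofAdd z))
  have hinv : hR * ↑uh⁻¹ = 1 := by rw [hhR, ← huh, Units.mul_inv]
  have hone : ∀ L : ℕ, hR ^ L * (↑uh⁻¹ : R) ^ L = 1 := fun L => by rw [← mul_pow, hinv, one_pow]
  have hcancel : ∀ (a b : R) (K L : ℕ), a * hR ^ L = b * hR ^ K → a * (↑uh⁻¹ : R) ^ K = b * (↑uh⁻¹ : R) ^ L := by
    intro a b K L h
    calc a * (↑uh⁻¹ : R) ^ K = a * (↑uh⁻¹ : R) ^ K * (hR ^ L * (↑uh⁻¹ : R) ^ L) := by rw [hone, mul_one]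
      _ = (a * hR ^ L) * (↑uh⁻¹ : R) ^ K * (↑uh⁻¹ : R) ^ L := by ring
      _ = (b * hR ^ K) * (↑uh⁻¹ : R) ^ K * (↑uh⁻¹ : R) ^ L := by rw [h]
      _ = b * (hR ^ K * (↑uh⁻¹ : R) ^ K) * (↑uh⁻¹ : R) ^ L := by ring
      _ = b * (↑uh⁻¹ : R) ^ L := by rw [hone, mul_one]
  have hψz : ∀ K : ℕ, algebraMap R₀ R (ψ (Multiplicative.ofAdd (K • z))) = hR ^ K := fun K => by
    rw [ofAdd_nsmul, map_pow, map_pow]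
  let ψ' : Multiplicative Ps →* R :=
    { toFun := fun x => algebraMap R₀ R (ψ (Multiplicative.ofAdd (lift x.toAdd))) * (↑uh⁻¹ : R) ^ Kf x.toAdd
      map_one' := by
        show algebraMap R₀ R (ψ (Multiplicative.ofAdd (lift 0))) * (↑uh⁻¹ : R) ^ Kf 0 = 1
        have hK0 : Kf 0 = 0 := by
          show ∑ j, (sP 0 j).natAbs = 0
          simp [hsP_zero]
        rw [hlift_zero, hK0, pow_zero, mul_one, ofAdd_zero, map_one, map_one]
      map_mul' := fun x y => by
        show algebraMap R₀ R (ψ (Multiplicative.ofAdd (lift (x.toAdd + y.toAdd)))) * (↑uh⁻¹ : R) ^ Kf (x.toAdd + y.toAdd) =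
          (algebraMap R₀ R (ψ (Multiplicative.ofAdd (lift x.toAdd))) * (↑uh⁻¹ : R) ^ Kf x.toAdd) *
          (algebraMap R₀ R (ψ (Multiplicative.ofAdd (lift y.toAdd))) * (↑uh⁻¹ : R) ^ Kf y.toAdd)
        have key := congrArg (fun q : P => algebraMap R₀ R (ψ (Multiplicative.ofAdd q))) (hlift_add x.toAdd y.toAdd)
        simp only [ofAdd_add, map_mul, hψz] at key
        -- key : ψ(lift x) ψ(lift y) h^{K(x+y)} = ψ(lift (x+y)) h^{Kx+Ky}
        have h2 := hcancel _ _ (Kf (x.toAdd + y.toAdd)) (Kf x.toAdd + Kf y.toAdd) key.symm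
        rw [h2, pow_add]
        ring }
  have hψ'apply : ∀ mv : Ps, ψ' (Multiplicative.ofAdd mv) =
      algebraMap R₀ R (ψ (Multiplicative.ofAdd (lift mv))) * (↑uh⁻¹ : R) ^ Kf mv := fun mv => rfl
  -- (4) the formula `ψ'(mv) · h^K = ψ(lift mv)`
  have hformula : ∀ mv : Ps, ψ' (Multiplicative.ofAdd mv) * hR ^ Kf mv =
      algebraMap R₀ R (ψ (Multiplicative.ofAdd (lift mv))) := by
    intro mv
    rw [hψ'apply, mul_assoc, mul_comm ((↑uh⁻¹ : R) ^ Kf mv), hone, mul_one]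
  -- vertical monomials `ψ(0, g)`, `Σ gⱼ c_{inr j} = 0`, are units in `R`
  have hvert_unit : ∀ g : Fin m → ℤ, 0 ≤ g → ∑ j, g j • c (e (Sum.inr j)) = 0 →
      ∀ (hg : (fun l => Sum.elim (fun _ : Fin n => (0 : ℤ)) g (e.symm l)) ∈ P),
      IsUnit (algebraMap R₀ R (ψ (Multiplicative.ofAdd ⟨_, hg⟩))) := by
    intro g hg0 hgsum hg
    set K : ℕ := ∑ j, (g j).natAbs with hK
    have hcomp_nonneg : ∀ j, 0 ≤ (K : ℤ) * (addOrderOf (c (e (Sum.inr j))) : ℤ) - g j := by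
      intro j
      have h1 : g j ≤ (K : ℤ) := by
        have : (g j).natAbs ≤ K :=
          Finset.single_le_sum (f := fun j => (g j).natAbs) (fun _ _ => Nat.zero_le _) (Finset.mem_univ j)
        have h' : g j = ((g j).natAbs : ℤ) := (Int.natAbs_of_nonneg (hg0 j)).symm
        rw [h']; exact_mod_cast this
      have h2 : (1 : ℤ) ≤ (addOrderOf (c (e (Sum.inr j))) : ℤ) := by exact_mod_cast hord j
      nlinarith
    have hg' : (fun l => Sum.elim (fun _ : Fin n => (0 : ℤ))
        (fun j => (K : ℤ) * (addOrderOf (c (e (Sum.inr j))) : ℤ) - g j) (e.symm l)) ∈ P := by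
      refine (helim _ _).mpr ⟨le_rfl, hcomp_nonneg, ?_⟩
      simp only [zero_smul, Finset.sum_const_zero, zero_add, sub_smul, Finset.sum_sub_distrib, hgsum, sub_zero]
      exact Finset.sum_eq_zero fun j _ => hKord _ j
    have hsum : (⟨_, hg⟩ : P) + ⟨_, hg'⟩ = K • z := by
      apply Subtype.ext
      apply hext
      · intro i; simp [hzK, hz₁]
      · intro j; simp [hzK, hz₂]
    have h := congrArg (fun q : P => algebraMap R₀ R (ψ (Multiplicative.ofAdd q))) hsum
    simp only [ofAdd_add, map_mul, hψz] at h
    have hu : IsUnit (hR ^ K) := by rw [hhR, ← huh]; exact (uh ^ K).isUnit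
    rw [← h] at hu
    exact isUnit_of_mul_isUnit_left hu
  refine ⟨π, ψ', hπapply, hπsurj, ?_, ?_, ?_⟩
  · -- (2) `ψ(p) = ψ'(π p) · unit`
    intro p
    obtain ⟨hp1, hp2, hp3⟩ := hmemP p
    set mv : Ps := π p with hmv
    set K' : ℕ := Kf mv + Kf mv with hK'
    let g : Fin m → ℤ := fun j => (p : Fin N → ℤ) (e (Sum.inr j)) + (K' : ℤ) * (addOrderOf (c (e (Sum.inr j))) : ℤ) -
      (sP mv j + (Kf mv : ℤ) * (addOrderOf (c (e (Sum.inr j))) : ℤ))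
    have hg0 : 0 ≤ g := by
      intro j
      show (0 : ℤ) ≤ (p : Fin N → ℤ) (e (Sum.inr j)) + (K' : ℤ) * (addOrderOf (c (e (Sum.inr j))) : ℤ) -
        (sP mv j + (Kf mv : ℤ) * (addOrderOf (c (e (Sum.inr j))) : ℤ))
      have h1 := hKf_ge mv j
      have h1' : (K' : ℤ) = (Kf mv : ℤ) + (Kf mv : ℤ) := by rw [hK']; push_cast; ring
      have h2 : (1 : ℤ) ≤ (addOrderOf (c (e (Sum.inr j))) : ℤ) := by exact_mod_cast hord j
      have h3 : sP mv j ≤ ((sP mv j).natAbs : ℤ) := by rw [Int.natCast_natAbs]; exact le_abs_self _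
      have h4 : 0 ≤ (p : Fin N → ℤ) (e (Sum.inr j)) := hp2 j
      have h5 : (0 : ℤ) ≤ (Kf mv : ℤ) := by positivity
      rw [h1']
      nlinarith [mul_le_mul_of_nonneg_left h2 h5]
    have hgsum : ∑ j, g j • c (e (Sum.inr j)) = 0 := by
      have hrel := hsP_rel mv
      have h1 : ∑ j, (p : Fin N → ℤ) (e (Sum.inr j)) • c (e (Sum.inr j)) = ∑ j, sP mv j • c (e (Sum.inr j)) := by
        have hA : ∑ i, (mv : Fin n → ℤ) i • c (e (Sum.inl i)) = ∑ i, (p : Fin N → ℤ) (e (Sum.inl i)) • c (e (Sum.inl i)) :=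
          Finset.sum_congr rfl fun i _ => by rw [hmv, hπapply]
        rw [hA] at hrel
        have := sub_eq_zero.mpr (hp3.trans hrel.symm)
        rwa [add_sub_add_left_eq_sub, sub_eq_zero] at this
      simp only [g, sub_smul, add_smul, Finset.sum_add_distrib, Finset.sum_sub_distrib, h1]
      rw [Finset.sum_eq_zero fun j _ => hKord (K' : ℤ) j, Finset.sum_eq_zero fun j _ => hKord (Kf mv : ℤ) j]
      abel
    have hg : (fun l => Sum.elim (fun _ : Fin n => (0 : ℤ)) g (e.symm l)) ∈ P :=
      (helim _ _).mpr ⟨le_rfl, hg0, by rw [hgsum]; simp⟩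
    have hsum : p + K' • z = lift mv + ⟨_, hg⟩ := by
      apply Subtype.ext
      apply hext
      · intro i; simp [hz₁, hlift_inl, hmv, hπapply]
      · intro j; simp [hz₂, hlift_inr, g]
    have h := congrArg (fun q : P => algebraMap R₀ R (ψ (Multiplicative.ofAdd q))) hsum
    simp only [ofAdd_add, map_mul, hψz] at h
    -- `h : ψ(p) · h^K' = ψ(lift mv) · ψ(0,g)`
    have hug := hvert_unit g hg0 hgsum hg
    refine ⟨hR ^ Kf mv * algebraMap R₀ R (ψ (Multiplicative.ofAdd ⟨_, hg⟩)) * (↑uh⁻¹ : R) ^ K',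
      ((by rw [hhR, ← huh]; exact (uh ^ Kf mv).isUnit : IsUnit (hR ^ Kf mv)).mul hug).mul ((Units.isUnit uh⁻¹).pow K'), ?_⟩
    · calc algebraMap R₀ R (ψ (Multiplicative.ofAdd p))
          = algebraMap R₀ R (ψ (Multiplicative.ofAdd p)) * (hR ^ K' * (↑uh⁻¹ : R) ^ K') := by rw [hone, mul_one]
        _ = (algebraMap R₀ R (ψ (Multiplicative.ofAdd p)) * hR ^ K') * (↑uh⁻¹ : R) ^ K' := by ring
        _ = (algebraMap R₀ R (ψ (Multiplicative.ofAdd (lift mv))) *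
              algebraMap R₀ R (ψ (Multiplicative.ofAdd ⟨_, hg⟩))) * (↑uh⁻¹ : R) ^ K' := by rw [h]
        _ = (ψ' (Multiplicative.ofAdd mv) * hR ^ Kf mv *
              algebraMap R₀ R (ψ (Multiplicative.ofAdd ⟨_, hg⟩))) * (↑uh⁻¹ : R) ^ K' := by rw [hformula]
        _ = ψ' (Multiplicative.ofAdd mv) *
              (hR ^ Kf mv * algebraMap R₀ R (ψ (Multiplicative.ofAdd ⟨_, hg⟩)) * (↑uh⁻¹ : R) ^ K') := by ring
  · -- (3) the formula
    intro mv
    exact ⟨lift mv, Kf mv, hlift_inl mv, hformula mv⟩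
  · -- (4) the vertical generators
    intro j
    let g : Fin m → ℤ := fun j' => if j' = j then (addOrderOf (c (e (Sum.inr j))) : ℤ) else 0
    have hg0 : 0 ≤ g := fun j' => by
      show (0 : ℤ) ≤ if j' = j then _ else 0
      split_ifs <;> positivity
    have hgsum : ∑ j', g j' • c (e (Sum.inr j')) = 0 := by
      simp only [g, ite_smul, zero_smul, Finset.sum_ite_eq', Finset.mem_univ, if_true, natCast_zsmul,
        addOrderOf_nsmul_eq_zero]
    have hg : (fun l => Sum.elim (fun _ : Fin n => (0 : ℤ)) g (e.symm l)) ∈ P :=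
      (helim _ _).mpr ⟨le_rfl, hg0, by rw [hgsum]; simp⟩
    exact ⟨⟨_, hg⟩, fun i => by simp, fun j' => by simp [g], hvert_unit g hg0 hgsum hg⟩

end Summit.ResolutionOfSingularities.ResolutionOfSingularities.Theorems.FRationalResolution.SharpChart
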